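import Literature.AlgebraicGeometry.Motives.HodgeLieWeilSquareRankOne
import Literature.AlgebraicGeometry.Motives.HodgeLieCommutantEigenspaces
import Literature.AlgebraicGeometry.Motives.HodgeLieSemisimpleOfTotallyRealCentre
import Literature.AlgebraicGeometry.Motives.HodgeThetaDerivedTimesAbelian
import Literature.Algebra.Lie.LieGoursatTwist
import Mathlib.LinearAlgebra.Matrix.SesquilinearForm
import HarnessLib

/-!
# The Weil square through Goursat–Kolchin–Ribet: LIFT, or a TWIST `W⁻ ≅ W⁺` / `W⁻ ≅ (W⁺)^*` of the traceless Hodge-degree-zero algebra — brick S2 of the (3|3) WEIL square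

Family `hodge`, layer `Literature/AlgebraicGeometry/Motives`, namespace `Literature.AlgebraicGeometry.Motives.HodgeStructure`, sub-namespace
`WeilSquare`. THEOREMS ONLY (no definition, no named fact, no `sorry`). Written for the cell `pub-hodgeav-hg6` (req-37 (A) Q2b; eng-4 g7, brick S2
of `HOME/jobs/WEIL33-eng4g7/DESIGN.md` REV 4 §5). HONEST FRAMING: nothing here proves HC / HC_AV / HC_CM; unconditional linear algebra of polarized
weight-one Hodge structures; no step towards a summit statement.

SETTING (`Motives/HodgeLieWeilSquareRankOne`, `Motives/HodgeLieWeilSquareLift`): `H` effective polarized of weight `1`, `φ ∈ End_Hdg(V)`, `φ² = −d`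
(`d > 0`), `μ² = −d`, `W = ker(φ_ℂ − μ)`, `W⁺ = W ∩ V^{1,0}`, `W⁻ = W ∩ V^{0,1}` (both of dimension `3`), `𝔥_ℂ = hodgeLieC H` with `𝔷(𝔥) = 0`,
`𝔊⁰` = the elements of `𝔥_ℂ` preserving `V^{1,0}` and `V^{0,1}`.

* §1 **`WeilSquare.trace_mul_baseChange_eq_zero`** — `tr(X a_ℂ) = 0` for `X ∈ 𝔥_ℂ`, `a ∈ End_Hdg(V)` when `𝔷(𝔥) = 0` (`𝔥 = [𝔥, 𝔥]`,
  `hodgeLie_eq_derived_of_center_eq_bot`, and cyclicity, `trace_spanC_derived_mul_baseChange_eq_zero`);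
  **`WeilSquare.trace_restrict_plus_add_minus`** — `tr(X|_{W⁺}) + tr(X|_{W⁻}) = 0` for `X ∈ 𝔊⁰` (`= tr(X P_W)`, `P_W = (2μ)⁻¹(μ + φ_ℂ)`).
* §2 **`WeilSquare.lift_or_twist`** — with `𝔇 = {X ∈ 𝔊⁰ : tr(X|_{W⁺}) = 0}` (bracket-closed, traceless on `W⁺` and on `W⁻` by §1) and the
  surjectivity `𝔊⁰|_{W±} = End(W±)` (bricks S1, hypotheses `hSp`, `hSm`), `Literature.Algebra.Lie.LieGoursatTwist.lift_or_twist_of_submodules`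
  gives, IN OPERATOR FORM: (LIFT) every traceless endomorphism of `W⁺` (resp. `W⁻`) is the restriction of an element of `𝔊⁰` vanishing on `W⁻`
  (resp. `W⁺`) — exactly the hypotheses `hLp`, `hLm` of `WeilSquare.mem_hodgeLieC_of_lift`; or (TWIST I) an injective `T : W⁻ → W⁺` with
  `X|_{W⁺} ∘ T = T ∘ X|_{W⁻}` for all `X ∈ 𝔇`; or (TWIST II) a pairing `κ : W⁺ × W⁻ → ℂ`, non-degenerate on the left, with
  `κ(Xp, w) + κ(p, Xw) = 0` for all `X ∈ 𝔇` (from the matrix forms `[X⁺] = A⁻¹[X⁻]^e A`, `[X⁺] = −A⁻¹([X⁻]^e)ᵀA`: `T = toLin A⁻¹`,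
  `κ = toLinearMap₂ Aᵀ` in the re-indexed basis). The two twists are excluded in the sequel (B1 / invariant-form bricks).

## References

* [Ribet1976RealMultiplications] K. A. Ribet, Amer. J. Math. 98 (1976), pp. 790–791.
* [Katz1990ESDE] N. M. Katz, *Exponential Sums and Differential Equations* (1990), §1.8, proof of Prop. 1.8.2.
* [Deligne1982HodgeCycles] P. Deligne, LNM 900 (1982), I §3 (Prop. 3.6: `𝔥` semisimple when the centre is trivial), §4 (p. 30).
* [MoonenZarhin1999LowDim] B. Moonen, Yu. Zarhin, Math. Ann. 315 (1999), §2 (2.3), §3 proof of Lemma (3.4).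
* [Gordon1997] B. B. Gordon, arXiv:alg-geom/9709030, §6 (proof of Thm. 6.3.3, pp. 18–19).
-/

noncomputable section

open scoped TensorProduct

namespace Literature.AlgebraicGeometry.Motives

namespace HodgeStructure

universe u

variable {V : Type u} [AddCommGroup V] [Module ℚ V] [Module.Finite ℚ V] [HodgeTensorFacts.{u, u}] {n : ℤ}

/-! ### §0 Plumbing -/

omit [Module.Finite ℚ V] [HodgeTensorFacts.{u, u}] in
/-- `tr_M(G ∘ p) = tr_U(G|_U)` for `p` with `p(M) ⊆ U`, `p = 1` on `U`, and `G` preserving `U`. Private plumbing. [folklore] -/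
private theorem WeilSquare.trace_mul_proj_eq {M : Type*} [AddCommGroup M] [Module ℂ M] [Module.Finite ℂ M]
    {U : Submodule ℂ M} {p G : Module.End ℂ M} (hpU : ∀ x, p x ∈ U) (hpid : ∀ u ∈ U, p u = u)
    (hG : ∀ u ∈ U, G u ∈ U) : LinearMap.trace ℂ M (G * p) = LinearMap.trace ℂ U (G.restrict hG) := by
  classical
  have hcompl : IsCompl U (LinearMap.ker p) := by
    refine ⟨Submodule.disjoint_def.2 fun x hxU hxK => ?_, codisjoint_iff.2 (Submodule.eq_top_iff'.2 fun x => ?_)⟩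
    · rw [LinearMap.mem_ker] at hxK
      rw [← hpid x hxU, hxK]
    · have hx : x = p x + (x - p x) := by abel
      rw [hx]
      refine Submodule.add_mem_sup (hpU x) ?_
      rw [LinearMap.mem_ker, map_sub, hpid _ (hpU x), sub_self]
  let N : Bool → Submodule ℂ M := fun b => cond b U (LinearMap.ker p)
  have hint : DirectSum.IsInternal N :=
    (DirectSum.isInternal_submodule_iff_isCompl N (i := true) (j := false) (by decide)
      (Set.eq_univ_of_forall fun b => by cases b <;> simp).symm).2 hcompl
  have hU' : Set.MapsTo (G * p) U U := fun u hu => by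
    simp only [SetLike.mem_coe] at hu ⊢
    rw [Module.End.mul_apply, hpid u hu]; exact hG u hu
  have hK' : Set.MapsTo (G * p) (LinearMap.ker p) (LinearMap.ker p) := fun x hx => by
    simp only [SetLike.mem_coe, LinearMap.mem_ker] at hx ⊢
    rw [Module.End.mul_apply, hx, map_zero, map_zero]
  have hmaps : ∀ b, Set.MapsTo (G * p) (N b) (N b) := fun b =>
    match b with
    | true => hU'
    | false => hK'
  have hsplit := LinearMap.trace_eq_sum_trace_restrict hint hmaps
  rw [Fintype.sum_bool] at hsplit
  have h1 : LinearMap.trace ℂ (N true) ((G * p).restrict (hmaps true)) = LinearMap.trace ℂ U (G.restrict hG) := by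
    change LinearMap.trace ℂ U ((G * p).restrict hU') = _
    congr 1
    exact LinearMap.ext fun u => Subtype.ext (by
      change (G * p) u = G u
      rw [Module.End.mul_apply, hpid u u.2])
  have h2 : LinearMap.trace ℂ (N false) ((G * p).restrict (hmaps false)) = 0 := by
    change LinearMap.trace ℂ (LinearMap.ker p) ((G * p).restrict hK') = 0
    have h0 : (G * p).restrict hK' = 0 :=
      LinearMap.ext fun x => Subtype.ext (by
        change (G * p) x = 0
        rw [Module.End.mul_apply, LinearMap.mem_ker.1 x.2, map_zero])
    rw [h0, map_zero]
  rw [hsplit, h1, h2, add_zero]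

omit [Module.Finite ℚ V] [HodgeTensorFacts.{u, u}] in
/-- Matrix of an endomorphism in a re-indexed basis: `[X]_{b∘e⁻¹} = [X]_b` re-indexed by `e⁻¹` on both sides. Private plumbing. [folklore] -/
private theorem WeilSquare.toMatrix_reindex_eq_submatrix {M : Type*} [AddCommGroup M] [Module ℂ M] {m : ℕ}
    (b : Module.Basis (Fin m) ℂ M) (e : Fin m ≃ Fin m) (X : Module.End ℂ M) :
    LinearMap.toMatrix (b.reindex e) (b.reindex e) X = (LinearMap.toMatrix b b X).submatrix e.symm e.symm := by
  ext i j
  rw [LinearMap.toMatrix_apply, Matrix.submatrix_apply, LinearMap.toMatrix_apply, Module.Basis.reindex_apply,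
    Module.Basis.repr_reindex_apply]

/-! ### §1 Tracelessness: `tr(X a_ℂ) = 0` on `𝔥_ℂ` when `𝔷(𝔥) = 0`; `tr(X|_{W⁺}) + tr(X|_{W⁻}) = 0` on `𝔊⁰` -/

/-- **`tr(X ∘ a_ℂ) = 0` for `X ∈ 𝔥_ℂ` and `a ∈ End_Hdg(V)` when `𝔷(𝔥) = 0`**: `𝔥 = [𝔥, 𝔥]` (`hodgeLie_eq_derived_of_center_eq_bot`), `a`
commutes with `𝔥`, and `tr([X, Y] a) = 0`. In particular (`a = 1`) every `X ∈ 𝔥_ℂ` is traceless.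
[cite: Deligne1982HodgeCycles, I §3 Prop. 3.6] [cite: MoonenZarhin1999LowDim, §2 (2.3)] -/
theorem WeilSquare.trace_mul_baseChange_eq_zero (H : HodgeStructure V n) (ψ : H.Polarization)
    (hz : H.hodgeLie ⊓ Subalgebra.toSubmodule H.endAlg = ⊥) {a : Module.End ℚ V} (ha : a ∈ H.endAlg)
    {X : Module.End ℂ (ℂ ⊗[ℚ] V)} (hX : X ∈ H.hodgeLieC) : LinearMap.trace ℂ _ (X * a.baseChange ℂ) = 0 := by
  rw [hodgeLieC_eq_spanC, ← hodgeLie_eq_derived_of_center_eq_bot ψ hz] at hX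
  exact trace_spanC_derived_mul_baseChange_eq_zero H.hodgeLie (fun Y hY => (commute_of_mem_hodgeLie H hY ⟨a, ha⟩).symm) hX

/-- **`tr(X|_{W⁺}) + tr(X|_{W⁻}) = 0` for `X ∈ 𝔥_ℂ` preserving `W⁺` and `W⁻`** (`𝔷(𝔥) = 0`): the sum is `tr(X ∘ P_W)` for the projector
`P_W = (2μ)⁻¹(μ + φ_ℂ) = π⁺P_W + π⁻P_W` onto `W = W⁺ ⊕ W⁻` (`π^± = ½(1 ± Θ)`), and `tr(X) = tr(X φ_ℂ) = 0` (§1).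
[cite: Deligne1982HodgeCycles, I §3 Prop. 3.6, §4 (p. 30)] [cite: Gordon1997, §6 (proof of Thm. 6.3.3, p. 19)] -/
theorem WeilSquare.trace_restrict_plus_add_minus (H : HodgeStructure V n) (hn : n = 1) (heff : H.IsEffective) (ψ : H.Polarization)
    {φ : Module.End ℚ V} (hφE : φ ∈ H.endAlg) {d : ℚ} (hd : 0 < d) (hφ2 : φ * φ = -(d • 1)) {μ : ℂ} (hμ : μ ^ 2 = -(d : ℂ))
    (hz : H.hodgeLie ⊓ Subalgebra.toSubmodule H.endAlg = ⊥) {X : Module.End ℂ (ℂ ⊗[ℚ] V)} (hX : X ∈ H.hodgeLieC)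
    (hXp : ∀ x ∈ Module.End.eigenspace (φ.baseChange ℂ) μ ⊓ H.piece 1 0, X x ∈ Module.End.eigenspace (φ.baseChange ℂ) μ ⊓ H.piece 1 0)
    (hXm : ∀ x ∈ Module.End.eigenspace (φ.baseChange ℂ) μ ⊓ H.piece 0 1, X x ∈ Module.End.eigenspace (φ.baseChange ℂ) μ ⊓ H.piece 0 1) :
    LinearMap.trace ℂ _ (X.restrict hXp) + LinearMap.trace ℂ _ (X.restrict hXm) = 0 := by
  classical
  subst hn
  set W := Module.End.eigenspace (φ.baseChange ℂ) μ with hWdef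
  set Wp := W ⊓ H.piece 1 0 with hWpdef
  set Wm := W ⊓ H.piece 0 1 with hWmdef
  obtain ⟨hμ0, -⟩ := UnitaryTheta.conj_eq_neg_of_sq hd hμ
  obtain ⟨Θ, hΘ⟩ := exists_hodgeTheta H
  obtain ⟨hPmem, hQmem, hΘ10, hΘ01, -⟩ := UnitaryTheta.theta_facts H rfl heff hΘ
  have hΘ𝔥 : Θ ∈ H.hodgeLieC := H.mem_hodgeLieC_of_forall_piece hΘ
  have hΘW : ∀ w ∈ W, Θ w ∈ W := fun w hw =>
    UnitaryTheta.apply_mem_eigenspace_of_commute (H.commute_baseChange_of_mem_hodgeLieC hΘ𝔥 ⟨φ, hφE⟩) hw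
  set πP : Module.End ℂ (ℂ ⊗[ℚ] V) := (2 : ℂ)⁻¹ • (1 + Θ) with hπPdef
  set πQ : Module.End ℂ (ℂ ⊗[ℚ] V) := (2 : ℂ)⁻¹ • (1 - Θ) with hπQdef
  have hπP : ∀ v, πP v = (2 : ℂ)⁻¹ • (v + Θ v) := fun v => by
    rw [hπPdef, LinearMap.smul_apply, LinearMap.add_apply, Module.End.one_apply]
  have hπQ : ∀ v, πQ v = (2 : ℂ)⁻¹ • (v - Θ v) := fun v => by
    rw [hπQdef, LinearMap.smul_apply, LinearMap.sub_apply, Module.End.one_apply]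
  have hπPQ : πP + πQ = 1 := LinearMap.ext fun v => by
    rw [LinearMap.add_apply, Module.End.one_apply, hπP, hπQ, ← smul_add, add_add_sub_cancel, ← two_smul ℂ v, smul_smul,
      inv_mul_cancel₀ (two_ne_zero' ℂ), one_smul]
  have hπPW : ∀ w ∈ W, πP w ∈ Wp := fun w hw => by
    rw [hπP]
    exact Submodule.mem_inf.2 ⟨Submodule.smul_mem _ _ (Submodule.add_mem _ hw (hΘW w hw)), hπP w ▸ hPmem w⟩
  have hπQW : ∀ w ∈ W, πQ w ∈ Wm := fun w hw => by
    rw [hπQ]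
    exact Submodule.mem_inf.2 ⟨Submodule.smul_mem _ _ (Submodule.sub_mem _ hw (hΘW w hw)), hπQ w ▸ hQmem w⟩
  have hπPp : ∀ p ∈ H.piece 1 0, πP p = p := fun p hp => by
    rw [hπP, hΘ10 p hp, ← two_smul ℂ p, smul_smul, inv_mul_cancel₀ (two_ne_zero' ℂ), one_smul]
  have hπQq : ∀ q ∈ H.piece 0 1, πQ q = q := fun q hq => by
    rw [hπQ, hΘ01 q hq, sub_neg_eq_add, ← two_smul ℂ q, smul_smul, inv_mul_cancel₀ (two_ne_zero' ℂ), one_smul]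
  set PW : Module.End ℂ (ℂ ⊗[ℚ] V) := (2 * μ)⁻¹ • (μ • (1 : Module.End ℂ (ℂ ⊗[ℚ] V)) + φ.baseChange ℂ) with hPWdef
  obtain ⟨hPWmem, hPWid, -⟩ := CentralEigen.projector_facts (V := V) hφ2 hμ hμ0
  have hp : LinearMap.trace ℂ _ (X.restrict hXp) = LinearMap.trace ℂ _ (X * (πP * PW)) :=
    (WeilSquare.trace_mul_proj_eq (fun v => by rw [Module.End.mul_apply]; exact hπPW _ (hPWmem v))
      (fun p hp => by rw [Module.End.mul_apply, hPWid p (Submodule.mem_inf.1 hp).1, hπPp p (Submodule.mem_inf.1 hp).2]) hXp).symm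
  have hm : LinearMap.trace ℂ _ (X.restrict hXm) = LinearMap.trace ℂ _ (X * (πQ * PW)) :=
    (WeilSquare.trace_mul_proj_eq (fun v => by rw [Module.End.mul_apply]; exact hπQW _ (hPWmem v))
      (fun w hw => by rw [Module.End.mul_apply, hPWid w (Submodule.mem_inf.1 hw).1, hπQq w (Submodule.mem_inf.1 hw).2]) hXm).symm
  have h1 : LinearMap.trace ℂ _ (X * (1 : Module.End ℚ V).baseChange ℂ) = 0 :=
    WeilSquare.trace_mul_baseChange_eq_zero H ψ hz H.endAlg.one_mem hX
  rw [LinearMap.baseChange_one, mul_one] at h1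
  have hφ : LinearMap.trace ℂ _ (X * φ.baseChange ℂ) = 0 := WeilSquare.trace_mul_baseChange_eq_zero H ψ hz hφE hX
  have hXPW : X * PW = (2 * μ)⁻¹ • (μ • X + X * φ.baseChange ℂ) := by
    rw [hPWdef, mul_smul_comm, mul_add, mul_smul_comm, mul_one]
  rw [hp, hm, ← map_add, ← mul_add, ← add_mul, hπPQ, one_mul, hXPW, map_smul, map_add, map_smul, h1, hφ, smul_zero, add_zero,
    smul_zero]

/-! ### §2 Goursat–Kolchin–Ribet for the pair `(W⁺, W⁻)`: LIFT, or a twist, in operator form -/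

set_option maxHeartbeats 4000000 in
/-- **LIFT or TWIST for the (3|3) Weil square.** `H` effective polarized of weight `1`, `φ ∈ End_Hdg(V)` with `φ² = −d`, `μ² = −d`,
`𝔷(𝔥) = 0`, `dim W⁺ = dim W⁻ = 3`, and every endomorphism of `W⁺` (resp. `W⁻`) the restriction of an element of `𝔊⁰` (bricks S1). Then
EITHER (LIFT) every traceless endomorphism of `W⁺` is the restriction of an element of `𝔊⁰` vanishing on `W⁻` AND every traceless
endomorphism of `W⁻` is the restriction of an element of `𝔊⁰` vanishing on `W⁺`; OR (TWIST I) there is an injective linear `T : W⁻ → W⁺`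
with `X|_{W⁺} ∘ T = T ∘ X|_{W⁻}` for every `X ∈ 𝔊⁰` traceless on `W⁺`; OR (TWIST II) there is a bilinear `κ : W⁺ × W⁻ → ℂ`, non-degenerate
on the left, with `κ(Xp, w) + κ(p, Xw) = 0` for every `X ∈ 𝔊⁰` traceless on `W⁺` — `LieGoursatTwist.lift_or_twist_of_submodules` for
`𝔇 = {X ∈ 𝔊⁰ : tr(X|_{W⁺}) = 0}` (bracket-closed; traceless on `W⁻` too by §1), bases of `W^±`, `i₀ = W⁺`, read back through `Matrix.toLin`
and `Matrix.toLinearMap₂`. [cite: Ribet1976RealMultiplications, pp. 790–791] [cite: Katz1990ESDE, §1.8 Prop. 1.8.2 (proof)]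
[cite: Deligne1982HodgeCycles, I §3 Prop. 3.6] -/
theorem WeilSquare.lift_or_twist (H : HodgeStructure V n) (hn : n = 1) (heff : H.IsEffective) (ψ : H.Polarization)
    {φ : Module.End ℚ V} (hφE : φ ∈ H.endAlg) {d : ℚ} (hd : 0 < d) (hφ2 : φ * φ = -(d • 1)) {μ : ℂ} (hμ : μ ^ 2 = -(d : ℂ))
    (hz : H.hodgeLie ⊓ Subalgebra.toSubmodule H.endAlg = ⊥)
    (hWp : Module.finrank ℂ ↥(Module.End.eigenspace (φ.baseChange ℂ) μ ⊓ H.piece 1 0) = 3)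
    (hWm : Module.finrank ℂ ↥(Module.End.eigenspace (φ.baseChange ℂ) μ ⊓ H.piece 0 1) = 3)
    (hSp : ∀ F : Module.End ℂ ↥(Module.End.eigenspace (φ.baseChange ℂ) μ ⊓ H.piece 1 0),
      ∃ Y ∈ H.hodgeLieC, (∀ p ∈ H.piece 1 0, Y p ∈ H.piece 1 0) ∧ (∀ q ∈ H.piece 0 1, Y q ∈ H.piece 0 1) ∧
        ∀ p : ↥(Module.End.eigenspace (φ.baseChange ℂ) μ ⊓ H.piece 1 0), Y p = F p)
    (hSm : ∀ F : Module.End ℂ ↥(Module.End.eigenspace (φ.baseChange ℂ) μ ⊓ H.piece 0 1),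
      ∃ Y ∈ H.hodgeLieC, (∀ p ∈ H.piece 1 0, Y p ∈ H.piece 1 0) ∧ (∀ q ∈ H.piece 0 1, Y q ∈ H.piece 0 1) ∧
        ∀ w : ↥(Module.End.eigenspace (φ.baseChange ℂ) μ ⊓ H.piece 0 1), Y w = F w) :
    ((∀ Z : Module.End ℂ ↥(Module.End.eigenspace (φ.baseChange ℂ) μ ⊓ H.piece 1 0), LinearMap.trace ℂ _ Z = 0 →
        ∃ X ∈ H.hodgeLieC, (∀ p ∈ H.piece 1 0, X p ∈ H.piece 1 0) ∧ (∀ q ∈ H.piece 0 1, X q ∈ H.piece 0 1) ∧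
          (∀ p : ↥(Module.End.eigenspace (φ.baseChange ℂ) μ ⊓ H.piece 1 0), X p = Z p) ∧
          ∀ w ∈ Module.End.eigenspace (φ.baseChange ℂ) μ ⊓ H.piece 0 1, X w = 0) ∧
      (∀ Z : Module.End ℂ ↥(Module.End.eigenspace (φ.baseChange ℂ) μ ⊓ H.piece 0 1), LinearMap.trace ℂ _ Z = 0 →
        ∃ X ∈ H.hodgeLieC, (∀ p ∈ H.piece 1 0, X p ∈ H.piece 1 0) ∧ (∀ q ∈ H.piece 0 1, X q ∈ H.piece 0 1) ∧
          (∀ w : ↥(Module.End.eigenspace (φ.baseChange ℂ) μ ⊓ H.piece 0 1), X w = Z w) ∧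
          ∀ p ∈ Module.End.eigenspace (φ.baseChange ℂ) μ ⊓ H.piece 1 0, X p = 0)) ∨
    (∃ T : ↥(Module.End.eigenspace (φ.baseChange ℂ) μ ⊓ H.piece 0 1) →ₗ[ℂ] ↥(Module.End.eigenspace (φ.baseChange ℂ) μ ⊓ H.piece 1 0),
      Function.Injective T ∧
        ∀ X ∈ H.hodgeLieC, (∀ p ∈ H.piece 1 0, X p ∈ H.piece 1 0) → (∀ q ∈ H.piece 0 1, X q ∈ H.piece 0 1) →
          ∀ (hXp : ∀ x ∈ Module.End.eigenspace (φ.baseChange ℂ) μ ⊓ H.piece 1 0, X x ∈ Module.End.eigenspace (φ.baseChange ℂ) μ ⊓ H.piece 1 0)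
            (hXm : ∀ x ∈ Module.End.eigenspace (φ.baseChange ℂ) μ ⊓ H.piece 0 1, X x ∈ Module.End.eigenspace (φ.baseChange ℂ) μ ⊓ H.piece 0 1),
            LinearMap.trace ℂ _ (X.restrict hXp) = 0 → X.restrict hXp ∘ₗ T = T ∘ₗ X.restrict hXm) ∨
    (∃ κ : ↥(Module.End.eigenspace (φ.baseChange ℂ) μ ⊓ H.piece 1 0) →ₗ[ℂ]
        ↥(Module.End.eigenspace (φ.baseChange ℂ) μ ⊓ H.piece 0 1) →ₗ[ℂ] ℂ,
      (∀ p, p ≠ 0 → ∃ w, κ p w ≠ 0) ∧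
        ∀ X ∈ H.hodgeLieC, (∀ p ∈ H.piece 1 0, X p ∈ H.piece 1 0) → (∀ q ∈ H.piece 0 1, X q ∈ H.piece 0 1) →
          ∀ (hXp : ∀ x ∈ Module.End.eigenspace (φ.baseChange ℂ) μ ⊓ H.piece 1 0, X x ∈ Module.End.eigenspace (φ.baseChange ℂ) μ ⊓ H.piece 1 0)
            (hXm : ∀ x ∈ Module.End.eigenspace (φ.baseChange ℂ) μ ⊓ H.piece 0 1, X x ∈ Module.End.eigenspace (φ.baseChange ℂ) μ ⊓ H.piece 0 1),
            LinearMap.trace ℂ _ (X.restrict hXp) = 0 → ∀ p w, κ (X.restrict hXp p) w + κ p (X.restrict hXm w) = 0) := by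
  classical
  subst hn
  set W := Module.End.eigenspace (φ.baseChange ℂ) μ with hWdef
  set Wp := W ⊓ H.piece 1 0 with hWpdef
  set Wm := W ⊓ H.piece 0 1 with hWmdef
  obtain ⟨hμ0, -⟩ := UnitaryTheta.conj_eq_neg_of_sq hd hμ
  have hbrC : ∀ Y ∈ H.hodgeLieC, ∀ Z ∈ H.hodgeLieC, Y * Z - Z * Y ∈ H.hodgeLieC := fun Y hY Z hZ => H.commutator_mem_hodgeLieC hY hZ
  have hcφ : ∀ {X}, X ∈ H.hodgeLieC → X * φ.baseChange ℂ = φ.baseChange ℂ * X := fun {X} hX =>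
    H.commute_baseChange_of_mem_hodgeLieC hX ⟨φ, hφE⟩
  have hXW : ∀ {X}, X ∈ H.hodgeLieC → ∀ w ∈ W, X w ∈ W := fun {X} hX w hw =>
    UnitaryTheta.apply_mem_eigenspace_of_commute (hcφ hX) hw
  have hpres : ∀ {X}, X ∈ H.hodgeLieC → (∀ p ∈ H.piece 1 0, X p ∈ H.piece 1 0) → ∀ x ∈ Wp, X x ∈ Wp := fun {X} hX hXP x hx =>
    Submodule.mem_inf.2 ⟨hXW hX x (Submodule.mem_inf.1 hx).1, hXP x (Submodule.mem_inf.1 hx).2⟩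
  have hpresm : ∀ {X}, X ∈ H.hodgeLieC → (∀ q ∈ H.piece 0 1, X q ∈ H.piece 0 1) → ∀ x ∈ Wm, X x ∈ Wm := fun {X} hX hXQ x hx =>
    Submodule.mem_inf.2 ⟨hXW hX x (Submodule.mem_inf.1 hx).1, hXQ x (Submodule.mem_inf.1 hx).2⟩
  -- the projector `π⁺ P_W` onto `W⁺` and the trace functional `τ⁺(X) = tr(X π⁺P_W)`
  obtain ⟨Θ, hΘ⟩ := exists_hodgeTheta H
  obtain ⟨hPmem, -, hΘ10, -, -⟩ := UnitaryTheta.theta_facts H rfl heff hΘ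
  have hΘ𝔥 : Θ ∈ H.hodgeLieC := H.mem_hodgeLieC_of_forall_piece hΘ
  set πP : Module.End ℂ (ℂ ⊗[ℚ] V) := (2 : ℂ)⁻¹ • (1 + Θ) with hπPdef
  have hπP : ∀ v, πP v = (2 : ℂ)⁻¹ • (v + Θ v) := fun v => by
    rw [hπPdef, LinearMap.smul_apply, LinearMap.add_apply, Module.End.one_apply]
  have hπPW : ∀ w ∈ W, πP w ∈ Wp := fun w hw => by
    rw [hπP]
    exact Submodule.mem_inf.2 ⟨Submodule.smul_mem _ _ (Submodule.add_mem _ hw (hXW hΘ𝔥 w hw)), hπP w ▸ hPmem w⟩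
  have hπPp : ∀ p ∈ H.piece 1 0, πP p = p := fun p hp => by
    rw [hπP, hΘ10 p hp, ← two_smul ℂ p, smul_smul, inv_mul_cancel₀ (two_ne_zero' ℂ), one_smul]
  set PW : Module.End ℂ (ℂ ⊗[ℚ] V) := (2 * μ)⁻¹ • (μ • (1 : Module.End ℂ (ℂ ⊗[ℚ] V)) + φ.baseChange ℂ) with hPWdef
  obtain ⟨hPWmem, hPWid, -⟩ := CentralEigen.projector_facts (V := V) hφ2 hμ hμ0
  set Pp : Module.End ℂ (ℂ ⊗[ℚ] V) := πP * PW with hPpdef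
  have hPp_mem : ∀ v, Pp v ∈ Wp := fun v => by rw [hPpdef, Module.End.mul_apply]; exact hπPW _ (hPWmem v)
  have hPp_id : ∀ p ∈ Wp, Pp p = p := fun p hp => by
    rw [hPpdef, Module.End.mul_apply, hPWid p (Submodule.mem_inf.1 hp).1, hπPp p (Submodule.mem_inf.1 hp).2]
  set τp : Module.End ℂ (ℂ ⊗[ℚ] V) →ₗ[ℂ] ℂ := (LinearMap.trace ℂ (ℂ ⊗[ℚ] V)) ∘ₗ LinearMap.mulRight ℂ Pp with hτpdef
  have hτp : ∀ {X} (hXp : ∀ x ∈ Wp, X x ∈ Wp), τp X = LinearMap.trace ℂ ↥Wp (X.restrict hXp) := fun {X} hXp => by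
    rw [hτpdef, LinearMap.comp_apply, LinearMap.mulRight_apply]
    exact WeilSquare.trace_mul_proj_eq hPp_mem hPp_id hXp
  -- `𝔇 = {X ∈ 𝔊⁰ : tr(X|_{W⁺}) = 0}`
  set 𝔇 : Submodule ℂ (Module.End ℂ (ℂ ⊗[ℚ] V)) :=
    H.hodgeLieC ⊓ (Submodule.compatibleMaps (H.piece 1 0) (H.piece 1 0) ⊓ Submodule.compatibleMaps (H.piece 0 1) (H.piece 0 1)) ⊓
      LinearMap.ker τp with h𝔇def
  have hmem𝔇 : ∀ X, X ∈ 𝔇 ↔ (X ∈ H.hodgeLieC ∧ ((∀ p ∈ H.piece 1 0, X p ∈ H.piece 1 0) ∧ (∀ q ∈ H.piece 0 1, X q ∈ H.piece 0 1))) ∧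
      τp X = 0 := fun X => by
    rw [h𝔇def, Submodule.mem_inf, Submodule.mem_inf, Submodule.mem_inf, LinearMap.mem_ker]
    exact Iff.rfl
  have hmk : ∀ {X}, X ∈ H.hodgeLieC → (∀ p ∈ H.piece 1 0, X p ∈ H.piece 1 0) → (∀ q ∈ H.piece 0 1, X q ∈ H.piece 0 1) →
      ∀ hXp : ∀ x ∈ Wp, X x ∈ Wp, LinearMap.trace ℂ _ (X.restrict hXp) = 0 → X ∈ 𝔇 := fun {X} hX hXP hXQ hXp htr =>
    (hmem𝔇 X).2 ⟨⟨hX, hXP, hXQ⟩, by rw [hτp hXp]; exact htr⟩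
  -- the family `(W⁺, W⁻)` indexed by `Bool`, with bases
  let Wf : Bool → Submodule ℂ (ℂ ⊗[ℚ] V) := fun i => cond i Wp Wm
  let bp : Module.Basis (Fin 3) ℂ ↥Wp := Module.finBasisOfFinrankEq ℂ ↥Wp hWp
  let bm : Module.Basis (Fin 3) ℂ ↥Wm := Module.finBasisOfFinrankEq ℂ ↥Wm hWm
  let b : ∀ i, Module.Basis (Fin 3) ℂ ↥(Wf i) := fun i => match i with
    | true => bp
    | false => bm
  have hWpres : ∀ X ∈ 𝔇, ∀ i, ∀ w ∈ Wf i, X w ∈ Wf i := by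
    intro X hX i
    obtain ⟨⟨hX𝔥, hXP, hXQ⟩, -⟩ := (hmem𝔇 X).1 hX
    cases i
    · exact hpresm hX𝔥 hXQ
    · exact hpres hX𝔥 hXP
  -- traces on `W⁺` and `W⁻`
  have htrp : ∀ X (hX : X ∈ 𝔇), LinearMap.trace ℂ _ (X.restrict (hWpres X hX true)) = 0 := fun X hX => by
    have h := ((hmem𝔇 X).1 hX).2
    rw [hτp (hWpres X hX true)] at h
    exact h
  have htrm : ∀ X (hX : X ∈ 𝔇), LinearMap.trace ℂ _ (X.restrict (hWpres X hX false)) = 0 := fun X hX => by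
    have h := WeilSquare.trace_restrict_plus_add_minus H rfl heff ψ hφE hd hφ2 hμ hz ((hmem𝔇 X).1 hX).1.1
      (hWpres X hX true) (hWpres X hX false)
    exact (eq_neg_of_add_eq_zero_right h).trans (neg_eq_zero.2 (htrp X hX))
  have htr𝔇 : ∀ X (hX : X ∈ 𝔇) i, LinearMap.trace ℂ _ (X.restrict (hWpres X hX i)) = 0 := fun X hX i =>
    match i with
    | true => htrp X hX
    | false => htrm X hX
  -- bracket-closed
  have hbr𝔇 : ∀ X ∈ 𝔇, ∀ Y ∈ 𝔇, X * Y - Y * X ∈ 𝔇 := by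
    intro X hX Y hY
    obtain ⟨⟨hX𝔥, hXP, hXQ⟩, -⟩ := (hmem𝔇 X).1 hX
    obtain ⟨⟨hY𝔥, hYP, hYQ⟩, -⟩ := (hmem𝔇 Y).1 hY
    have hCP : ∀ p ∈ H.piece 1 0, (X * Y - Y * X) p ∈ H.piece 1 0 := fun p hp => by
      rw [LinearMap.sub_apply, Module.End.mul_apply, Module.End.mul_apply]
      exact Submodule.sub_mem _ (hXP _ (hYP p hp)) (hYP _ (hXP p hp))
    have hCQ : ∀ q ∈ H.piece 0 1, (X * Y - Y * X) q ∈ H.piece 0 1 := fun q hq => by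
      rw [LinearMap.sub_apply, Module.End.mul_apply, Module.End.mul_apply]
      exact Submodule.sub_mem _ (hXQ _ (hYQ q hq)) (hYQ _ (hXQ q hq))
    have hC𝔥 := hbrC X hX𝔥 Y hY𝔥
    refine hmk hC𝔥 hCP hCQ (hpres hC𝔥 hCP) ?_
    have heq : (X * Y - Y * X).restrict (hpres hC𝔥 hCP) =
        ⁅X.restrict (hpres hX𝔥 hXP), Y.restrict (hpres hY𝔥 hYP)⁆ := by
      rw [Ring.lie_def]
      exact LinearMap.ext fun w => Subtype.ext rfl
    rw [heq]
    exact LinearMap.trace_lie _ _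
  -- surjectivity of the two restrictions
  have hproj𝔇 : ∀ i, ∀ Z : Module.End ℂ ↥(Wf i), LinearMap.trace ℂ _ Z = 0 → ∃ X ∈ 𝔇, ∀ w : ↥(Wf i), X w = Z w := by
    intro i
    cases i
    · intro Z hZ
      obtain ⟨Y, hY, hYP, hYQ, hYZ⟩ := hSm Z
      have hres : Y.restrict (hpresm hY hYQ) = Z := LinearMap.ext fun w => Subtype.ext (by rw [LinearMap.coe_restrict_apply]; exact hYZ w)
      refine ⟨Y, hmk hY hYP hYQ (hpres hY hYP) ?_, hYZ⟩
      have h := WeilSquare.trace_restrict_plus_add_minus H rfl heff ψ hφE hd hφ2 hμ hz hY (hpres hY hYP) (hpresm hY hYQ)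
      have hb : LinearMap.trace ℂ ↥Wm (Y.restrict (hpresm hY hYQ)) = 0 := by rw [hres]; exact hZ
      exact (eq_neg_of_add_eq_zero_left h).trans (neg_eq_zero.2 hb)
    · intro Z hZ
      obtain ⟨Y, hY, hYP, hYQ, hYZ⟩ := hSp Z
      have hres : Y.restrict (hpres hY hYP) = Z := LinearMap.ext fun p => Subtype.ext (by rw [LinearMap.coe_restrict_apply]; exact hYZ p)
      refine ⟨Y, hmk hY hYP hYQ (hpres hY hYP) (by rw [hres]; exact hZ), hYZ⟩
  -- Goursat–Kolchin–Ribet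
  rcases Literature.Algebra.Lie.LieGoursatTwist.lift_or_twist_of_submodules (k := ℂ) Wf (d := 3) (by norm_num) b 𝔇 hbr𝔇 hWpres
      htr𝔇 hproj𝔇 true with hlift | ⟨j, hj, e, A, hA, htw⟩
  · -- LIFT
    left
    have hLp : ∀ Z : Module.End ℂ ↥Wp, LinearMap.trace ℂ _ Z = 0 →
        ∃ X ∈ H.hodgeLieC, (∀ p ∈ H.piece 1 0, X p ∈ H.piece 1 0) ∧ (∀ q ∈ H.piece 0 1, X q ∈ H.piece 0 1) ∧
          (∀ p : ↥Wp, X p = Z p) ∧ ∀ w ∈ Wm, X w = 0 := by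
      intro Z hZ
      obtain ⟨X, hX, hXZ, hX0⟩ := hlift Z hZ
      obtain ⟨⟨hX𝔥, hXP, hXQ⟩, -⟩ := (hmem𝔇 X).1 hX
      exact ⟨X, hX𝔥, hXP, hXQ, hXZ, fun w hw => hX0 false Bool.false_ne_true w hw⟩
    refine ⟨hLp, fun Z hZ => ?_⟩
    obtain ⟨X₁, hX₁, hX₁Z⟩ := hproj𝔇 false Z hZ
    obtain ⟨⟨hX₁𝔥, hX₁P, hX₁Q⟩, -⟩ := (hmem𝔇 X₁).1 hX₁
    obtain ⟨X₂, hX₂𝔥, hX₂P, hX₂Q, hX₂Z, hX₂0⟩ := hLp (X₁.restrict (hWpres X₁ hX₁ true)) (htrp X₁ hX₁)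
    refine ⟨X₁ - X₂, H.hodgeLieC.sub_mem hX₁𝔥 hX₂𝔥, fun p hp => ?_, fun q hq => ?_, fun w => ?_, fun p hp => ?_⟩
    · rw [LinearMap.sub_apply]; exact Submodule.sub_mem _ (hX₁P p hp) (hX₂P p hp)
    · rw [LinearMap.sub_apply]; exact Submodule.sub_mem _ (hX₁Q q hq) (hX₂Q q hq)
    · rw [LinearMap.sub_apply, hX₂0 _ w.2, sub_zero]
      exact hX₁Z w
    · have h := hX₂Z ⟨p, hp⟩
      rw [LinearMap.coe_restrict_apply] at h
      rw [LinearMap.sub_apply, h, sub_self]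
  · -- TWIST: `j = W⁻`
    right
    have hjf : j = false := by
      cases j
      · rfl
      · exact absurd rfl hj
    subst hjf
    set bm' : Module.Basis (Fin 3) ℂ ↥Wm := bm.reindex e with hbm'
    have hsub : ∀ X (hX : X ∈ 𝔇), (LinearMap.toMatrix (b false) (b false) (X.restrict (hWpres X hX false))).submatrix e.symm e.symm =
        LinearMap.toMatrix bm' bm' (X.restrict (hWpres X hX false)) := fun X hX =>
      (WeilSquare.toMatrix_reindex_eq_submatrix bm e _).symm
    have hAdet : IsUnit A.det := (Matrix.isUnit_iff_isUnit_det A).1 hA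
    have hAA : A * A⁻¹ = 1 := Matrix.mul_nonsing_inv A hAdet
    have hAA' : A⁻¹ * A = 1 := Matrix.nonsing_inv_mul A hAdet
    rcases htw with hI | ⟨-, hII⟩
    · -- TWIST I: `T = toLin A⁻¹ : W⁻ → W⁺`
      left
      set T : ↥Wm →ₗ[ℂ] ↥Wp := Matrix.toLin bm' bp A⁻¹ with hTdef
      have hTmat : LinearMap.toMatrix bm' bp T = A⁻¹ := by rw [hTdef, LinearMap.toMatrix_toLin]
      have hTinv : Matrix.toLin bp bm' A ∘ₗ T = LinearMap.id := by
        rw [hTdef, ← Matrix.toLin_mul bm' bp bm' A A⁻¹, hAA, Matrix.toLin_one]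
      refine ⟨T, fun x y hxy => ?_, fun X hX𝔥 hXP hXQ hXp hXm htr => ?_⟩
      · have h := congrArg (Matrix.toLin bp bm' A) hxy
        rw [← LinearMap.comp_apply, ← LinearMap.comp_apply, hTinv, LinearMap.id_apply, LinearMap.id_apply] at h
        exact h
      · have hX𝔇 : X ∈ 𝔇 := hmk hX𝔥 hXP hXQ hXp htr
        have hrel : LinearMap.toMatrix bp bp (X.restrict hXp) = A⁻¹ * LinearMap.toMatrix bm' bm' (X.restrict hXm) * A := by
          have h := hI X hX𝔇
          rw [hsub X hX𝔇] at h
          exact h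
        apply (LinearMap.toMatrix bm' bp).injective
        rw [LinearMap.toMatrix_comp bm' bp bp (X.restrict hXp) T, LinearMap.toMatrix_comp bm' bm' bp T (X.restrict hXm), hTmat, hrel,
          Matrix.mul_assoc (A⁻¹ * _) A A⁻¹, hAA, Matrix.mul_one]
    · -- TWIST II: `κ = toLinearMap₂ Aᵀ : W⁺ × W⁻ → ℂ`
      right
      set κ : ↥Wp →ₗ[ℂ] ↥Wm →ₗ[ℂ] ℂ := Matrix.toLinearMap₂ bp bm' A.transpose with hκdef
      have hκmat : LinearMap.toMatrix₂ bp bm' κ = A.transpose := by rw [hκdef, LinearMap.toMatrix₂_toLinearMap₂]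
      have hκb : ∀ (p : ↥Wp) (i : Fin 3), κ p (bm' i) = A.mulVec (⇑(bp.repr p)) i := fun p i => by
        rw [hκdef, Matrix.toLinearMap₂_apply]
        simp only [Module.Basis.repr_self, Finsupp.single_apply, Matrix.transpose_apply, smul_eq_mul, ite_mul, one_mul, zero_mul,
          mul_ite, mul_zero, Finset.sum_ite_eq, Finset.mem_univ, if_true, Matrix.mulVec, dotProduct]
        exact Finset.sum_congr rfl fun x _ => mul_comm _ _
      refine ⟨κ, fun p hp0 => ?_, fun X hX𝔥 hXP hXQ hXp hXm htr p w => ?_⟩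
      · by_contra hall
        push Not at hall
        have hv : A.mulVec ⇑(bp.repr p) = 0 := funext fun i => by rw [← hκb p i]; exact hall _
        have hv' : (⇑(bp.repr p) : Fin 3 → ℂ) = 0 := by
          rw [← Matrix.one_mulVec (⇑(bp.repr p) : Fin 3 → ℂ), ← hAA', ← Matrix.mulVec_mulVec, hv, Matrix.mulVec_zero]
        apply hp0
        have h0 : bp.repr p = 0 := Finsupp.ext fun i => by
          have := congrFun hv' i
          simpa using this
        exact bp.repr.map_eq_zero_iff.1 h0
      · have hX𝔇 : X ∈ 𝔇 := hmk hX𝔥 hXP hXQ hXp htr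
        have hrel : LinearMap.toMatrix bp bp (X.restrict hXp) = -(A⁻¹ * (LinearMap.toMatrix bm' bm' (X.restrict hXm)).transpose * A) := by
          have h := hII X hX𝔇
          rw [hsub X hX𝔇] at h
          exact h
        set Xp := LinearMap.toMatrix bp bp (X.restrict hXp) with hXpdef
        set Xm := LinearMap.toMatrix bm' bm' (X.restrict hXm) with hXmdef
        have hmat : Xp.transpose * A.transpose + A.transpose * Xm = 0 := by
          have h1 : A * Xp = -(Xm.transpose * A) := by
            rw [hrel, Matrix.mul_neg, ← Matrix.mul_assoc, ← Matrix.mul_assoc, hAA, Matrix.one_mul]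
          have h2 : Xp.transpose * A.transpose = -(A.transpose * Xm) := by
            rw [← Matrix.transpose_mul, h1, Matrix.transpose_neg, Matrix.transpose_mul, Matrix.transpose_transpose]
          rw [h2, neg_add_cancel]
        have hB : κ.comp (X.restrict hXp) + κ.compl₂ (X.restrict hXm) = 0 := by
          apply (LinearMap.toMatrix₂ bp bm').injective
          rw [map_add, map_zero, LinearMap.toMatrix₂_comp (b₁ := bp) (b₂ := bm') (b₁' := bp), LinearMap.toMatrix₂_compl₂ (b₁ := bp)
            (b₂ := bm') (b₂' := bm'), hκmat, ← hXpdef, ← hXmdef, hmat]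
        have h := congrArg (fun B : ↥Wp →ₗ[ℂ] ↥Wm →ₗ[ℂ] ℂ => B p w) hB
        simp only [LinearMap.add_apply, LinearMap.comp_apply, LinearMap.compl₂_apply, LinearMap.zero_apply] at h
        exact h

end HodgeStructure

end Literature.AlgebraicGeometry.Motives

end
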